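import Mathlib
import Literature.Analysis.FluidPDE.SelfSimilar
import Literature.Analysis.FluidPDE.AxisymmetricEuler
import Literature.Analysis.FluidPDE.CurlIsometryCovariance
import Literature.Analysis.FluidPDE.MildSolutionIsometryCovariance
import Summits.NavierStokesRegularity.NavierStokesRegularity.Theorems.ThreadingFluxSilentShellsLocalAxisTrigger
import HarnessLib

/-!
# Crux `PoloidalLiouville` (stmt-NavierStokesRegularity-1222, W1), crux idea «silent-shells» (ns-idea-15):
# the local-axis trigger about an ARBITRARY axis through the centre

The landed trigger `SilentShells.localAxisTrigger0` (p703116; sketch v1.4 l.563 `LocalAxisTrigger0`) takes the symmetry axis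
to be the `e_z`-axis, "WLOG by the Euclidean covariance of the class" (sketch l.556).  This file makes the WLOG a theorem:
`localAxisTrigger_anyAxis` — in W1's class (bounded ancient mild, a.e.-measurable slices, smooth on the open past slab,
unthreaded about `0`), if ONE slice is axisymmetric on ONE non-empty open set about the axis `L⁻¹(ℝ e_z)` for ANY linear
isometry `L` of `ℝ³` (i.e. `v t₁ (L⁻¹ R_θ L x) = L⁻¹ R_θ L (v t₁ x)` there), then every slice is constant.  Proof: the
conjugated field `w t = L ∘ v t ∘ L⁻¹` is again in the class (`IsBoundedAncientMildSolution.conj_linearIsometryEquiv`),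
has a.e.-measurable slices (`aestronglyMeasurable_conj_linearIsometryEquiv`), is smooth on the slab, is unthreaded about
`0` (the curl is a pseudo-vector: `curl_conj_linearIsometryEquiv`, and `L` preserves inner products), and is locally
axisymmetric about `e_z` on `L '' S`; `localAxisTrigger0` makes its slices constant, hence those of `v`.

So a hypothetical ⟨1222⟩ counterexample is nowhere locally axisymmetric about ANY axis through its centre, at any time —
as a tree theorem rather than a remark.  `PoloidalLiouville` (1222), W1 and NS regularity stay OPEN / NOT proved.
`--supports stmt-NavierStokesRegularity-1222 --as helper`; 0 kit.  [folklore]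
-/

-- the summit and its single problem share the name (D-0017 nested layout)
set_option linter.dupNamespace false

noncomputable section

open Set Function Filter Topology Metric MeasureTheory
open scoped Topology ENNReal RealInnerProductSpace
open Literature.Analysis Literature.Analysis.FluidPDE

namespace Summit.NavierStokesRegularity.NavierStokesRegularity.Theorems.PoloidalLiouville.SilentShells

open Summit.NavierStokesRegularity.NavierStokesRegularity.Theorems
open Summit.NavierStokesRegularity.NavierStokesRegularity.Theorems.PoloidalLiouville.NetFlux (E3)

/-- **The local-axis trigger about an arbitrary axis through the centre.**  In W1's class (bounded ancient mild solution,
a.e.-measurable slices, jointly smooth on `(−∞,0) × ℝ³`, unthreaded about `0`), suppose some slice `v t₁` is axisymmetric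
on a non-empty open set `S` about the axis `L.symm '' (ℝ e_z)`, `L` a linear isometry of `ℝ³` — i.e.
`v t₁ (L⁻¹ (R_θ (L x))) = L⁻¹ (R_θ (L (v t₁ x)))` for all `θ` and `x ∈ S`.  Then every slice of `v` is constant
(`localAxisTrigger0` applied to the conjugated field `L ∘ v t ∘ L⁻¹`). [folklore] -/
theorem localAxisTrigger_anyAxis
    (v : ℝ → E3 → E3) (hv : IsBoundedAncientMildSolution 1 v)
    (hmeas : ∀ t < 0, AEStronglyMeasurable (v t) volume)
    (hsm : ContDiffOn ℝ (⊤ : ℕ∞) (Function.uncurry v) (Set.Iio 0 ×ˢ Set.univ))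
    (hunthr : ∀ t < 0, ∀ x, ⟪x, curl (v t) x⟫ = 0)
    (L : E3 ≃ₗᵢ[ℝ] E3) {t₁ : ℝ} (ht₁ : t₁ < 0) {S : Set E3} (hS : IsOpen S) (hne : S.Nonempty)
    (hloc : ∀ θ : ℝ, ∀ x ∈ S, v t₁ (L.symm (rotZ θ (L x))) = L.symm (rotZ θ (L (v t₁ x)))) :
    ∀ t < 0, ∃ b : E3, ∀ x, v t x = b := by
  -- the conjugated field
  set w : ℝ → E3 → E3 := fun t y => L (v t (L.symm y)) with hw
  have hwclass : IsBoundedAncientMildSolution 1 w := hv.conj_linearIsometryEquiv L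
  have hwmeas : ∀ t < 0, AEStronglyMeasurable (w t) volume := fun t ht =>
    aestronglyMeasurable_conj_linearIsometryEquiv L (hmeas t ht)
  have hwsm : ContDiffOn ℝ (⊤ : ℕ∞) (Function.uncurry w) (Set.Iio 0 ×ˢ Set.univ) := by
    have hg : ContDiff ℝ (⊤ : ℕ∞) (fun p : ℝ × E3 => ((p.1, L.symm p.2) : ℝ × E3)) :=
      contDiff_fst.prodMk ((L.symm : E3 →L[ℝ] E3).contDiff.comp contDiff_snd)
    have hmaps : MapsTo (fun p : ℝ × E3 => ((p.1, L.symm p.2) : ℝ × E3))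
        (Set.Iio (0 : ℝ) ×ˢ (Set.univ : Set E3)) (Set.Iio (0 : ℝ) ×ˢ (Set.univ : Set E3)) :=
      fun p hp => ⟨hp.1, mem_univ _⟩
    have h1 := hsm.comp hg.contDiffOn hmaps
    have h2 := ((L : E3 →L[ℝ] E3).contDiff (n := (⊤ : ℕ∞))).comp_contDiffOn h1
    have e : Function.uncurry w =
        (L : E3 →L[ℝ] E3) ∘ (Function.uncurry v ∘ fun p : ℝ × E3 => ((p.1, L.symm p.2) : ℝ × E3)) := by
      funext p
      rfl
    rw [e]
    exact h2
  have hwun : ∀ t < 0, ∀ y, ⟪y, curl (w t) y⟫ = 0 := by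
    intro t ht y
    have h1 : curl (w t) y = (L : E3 →L[ℝ] E3).det • L (curl (v t) (L.symm y)) :=
      curl_conj_linearIsometryEquiv L (v t) y
    rw [h1, inner_smul_right]
    have h2 : ⟪L (L.symm y), L (curl (v t) (L.symm y))⟫ = ⟪L.symm y, curl (v t) (L.symm y)⟫ :=
      L.inner_map_map _ _
    rw [L.apply_symm_apply] at h2
    rw [h2, hunthr t ht (L.symm y), mul_zero]
  -- local axisymmetry of `w t₁` about `e_z` on `L '' S`
  have hS' : IsOpen (L '' S) := L.toHomeomorph.isOpenMap S hS
  have hne' : (L '' S).Nonempty := hne.image _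
  have hloc' : ∀ θ : ℝ, ∀ y ∈ L '' S, w t₁ (rotZ θ y) = rotZ θ (w t₁ y) := by
    rintro θ y ⟨x, hx, rfl⟩
    simp only [hw, LinearIsometryEquiv.symm_apply_apply]
    rw [hloc θ x hx, LinearIsometryEquiv.apply_symm_apply]
  -- the trigger for `w`, read back for `v`
  intro t ht
  obtain ⟨b, hb⟩ := localAxisTrigger0 w hwclass hwmeas hwsm hwun ⟨t₁, ht₁, L '' S, hS', hne', hloc'⟩ t ht
  refine ⟨L.symm b, fun x => ?_⟩
  have hx := hb (L x)
  simp only [hw, LinearIsometryEquiv.symm_apply_apply] at hx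
  rw [← hx, LinearIsometryEquiv.symm_apply_apply]

end Summit.NavierStokesRegularity.NavierStokesRegularity.Theorems.PoloidalLiouville.SilentShells
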